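import Summits.QuantumFields.BalabanUV.Beta.AxialCoordinateProjector
import Summits.QuantumFields.BalabanUV.Beta.AxialDressingRootedReflection
import Summits.QuantumFields.BalabanUV.Beta.SpineRootedStep

/-!
# `hR` for the ρ-threaded dressed spine `SpineRooted.JsBalAtOf` AT THE CENTRED ROOT — the wiring of (ii-0), (ii-2a), (iii′)/(iv′) and
# rules 1–2 of (ii-1): what remains is EXACTLY rules 3–4 and the undressed conjugated jet laws
# (β sub-cell, row BETA-an2, gen 12)

HONEST FRAMING (cell charter, verbatim): «discharging BetaPertH makes Balaban's UV stability UNCONDITIONAL — a real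
constructive-QFT result; it is NOT the continuum limit and NOT the Clay problem.»  DERIVED cell leaf; no statement of Bałaban's
papers is typed here, no `[cite:]` tag, no `Prop` fact, no `def`; it instantiates no binder of the β-function wall by itself.
NOT `BetaPertH`; NOT continuum; NOT Clay.

## What is here

ONE theorem, **`axisReflectionCovariant_flipK_TbalOf_JsBalAtOf_ctr`**: for `Odd Lc`, ANY colour constants and ANY block-covariant
second-order tables `W` (`hWt`), the centred dressed family `SpineRooted.JsBalAtOf hLc (ctrOff_mem_box hLc) cE cVH cΛ W Cw δw hδw hW`
(`= dressAt ctr ∘ JsBal0AtOf …` by `rfl`; the wall literal `JsBalAn1AtCtr` is the instance `W := WbalT2AtOf …` with an1's tables)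
satisfies `∀ j, AxisReflectionCovariant (flipK (TbalOf Lc … j))` — the `hR` hypothesis of `OneStepKernelFamily.d1Drift_of_D1Tel_D1Rep` —
from EXACTLY these BINDERS (with `G_j := coDressKAt ctr Lc (KInvStep Lc j)`, `E := axE ctr Lc` the axial coordinate projector):
* a spread kernel `𝕄 j` per step with RULES 3–4 `(G_j ∘ 𝕄 j) ∘ E = E`, `(E ∘ 𝕄 j) ∘ G_j = E` (item (ii-1): `G_j` inverts the undressed
  bordered step Hessian on the hard axial gauge — NO supplier in the tree);
* local contact-generator families `C j α` and localised second-order contacts `X₂ j α` COMMUTING WITH `E`;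
* the CONJUGATED reflection laws (Sr-conj)/(Wr-conj) of the UNDRESSED jets `JsBal0AtOf … j` against `𝕄 j` (items (ii-2)/(ii-3)).
DISCHARGED inside: the co-dressed form of the kernels (`TbalOf_dressAt`), decay ∕ block covariance ∕ reflection invariance of `G_j`
(`refK_coDressKAt_KInvStep`), rules 1–2 (`axE_rules_coDressKAt_KInvStep`), `Spr E` (`spr_axE`), and the translation sockets (St)/(Wt)
(`SpineRooted.JsBal0AtOf_S_translate` / `JsBal0AtOf_W_translate`).

All declarations `[folklore]`; axioms standard.  Provenance: b2b-balaban β sub-cell, unit beta-an2 gen 12, 2026-08-19 (v1); no existing file touched.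
-/

open Finset
open scoped BigOperators
open Literature.MathematicalPhysics.QuantumFieldTheory
open Literature.MathematicalPhysics.QuantumFieldTheory.Balaban1983to89
open Literature.MathematicalPhysics.QuantumFieldTheory.Balaban1983to89.Beta
open ExpKernelCalculus (MKer Decays BiLoc comp VertexFamily₂ shiftK)
open AffineAveraging (box toSite)
open AveragingContoursRooted (ctrOff ctrOff_mem_box)
open PolarizationSign (reflSign AxisReflectionCovariant)
open KernelReflection (refK)
open ResolventReflection (bref Φ)
open OneStepResolventKernel (Fib LocStencil JetData)
open OneStepKernelFamily (KInvStep vertexOfK TbalOf flipK)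
open Summit.QuantumFields.BalabanUV.Beta.TameKernelCalculus
open Summit.QuantumFields.BalabanUV.Beta.ChartConjugation (conjV conjW)
open Summit.QuantumFields.BalabanUV.Beta.ChartConjugationRelative (RelInv)
open Summit.QuantumFields.BalabanUV.Beta.AxialDressingRooted (coDressKAt axE spr_axE axE_rules_coDressKAt_KInvStep
  axisReflectionCovariant_flipK_TbalOf_dressCtr_rel one_le_of_neZero)

namespace Summit.QuantumFields.BalabanUV.Beta.SpineRooted

noncomputable section

/-- [folklore] **`hR` FOR THE CENTRED DRESSED SPINE FROM RULES 3–4 AND THE UNDRESSED CONJUGATED JET LAWS ONLY.**  See the module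
docstring for the exact list of binders and of what is discharged inside.  Discharges nothing of the wall by itself. -/
theorem axisReflectionCovariant_flipK_TbalOf_JsBalAtOf_ctr {Lc : ℕ} [NeZero Lc] (hLc : Odd Lc) (cE cVH cΛ : ℝ)
    (W : ℕ → Fin 4 → (Fin 4 → ℤ) → Fin 4 → (Fin 4 → ℤ) → MKer 4 (Fib 3)) (Cw δw : ℕ → ℝ) (hδw : ∀ j, 0 < δw j)
    (hW : ∀ j, VertexFamily₂ (W j) Lc (Cw j) (δw j))
    (hWt : ∀ (j : ℕ) (μ : Fin 4) (y : Fin 4 → ℤ) (ν : Fin 4) (y' t : Fin 4 → ℤ),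
      W j μ (y + t) ν (y' + t) = shiftK (-((Lc : ℤ) • t)) (W j μ y ν y'))
    (M : ℕ → MKer 4 (Fib 3)) (hM : ∀ j, Spr (M j))
    (h3 : ∀ j, comp (comp (coDressKAt (toSite (ctrOff 4 Lc)) Lc (KInvStep (d := 3) Lc j)) (M j)) (axE (toSite (ctrOff 4 Lc)) Lc) =
      axE (toSite (ctrOff 4 Lc)) Lc)
    (h4 : ∀ j, comp (comp (axE (toSite (ctrOff 4 Lc)) Lc) (M j)) (coDressKAt (toSite (ctrOff 4 Lc)) Lc (KInvStep (d := 3) Lc j)) =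
      axE (toSite (ctrOff 4 Lc)) Lc)
    (C : ℕ → Fin 4 → Fin 4 → (Fin 4 → ℤ) → MKer 4 (Fib 3)) (Cc δc : ℕ → ℝ) (hC : ∀ j α, LocStencil (C j α) (Cc j) (δc j))
    (hδc : ∀ j, 0 < δc j) (X₂ : ℕ → Fin 4 → Fin 4 → (Fin 4 → ℤ) → Fin 4 → (Fin 4 → ℤ) → MKer 4 (Fib 3))
    (hX₂ : ∀ j α μ y ν y', Loc (X₂ j α μ y ν y'))
    (hEC : ∀ j α κ' u, comp (axE (toSite (ctrOff 4 Lc)) Lc) (C j α κ' u) = comp (C j α κ' u) (axE (toSite (ctrOff 4 Lc)) Lc))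
    (hEX₂ : ∀ j α μ y ν y', comp (axE (toSite (ctrOff 4 Lc)) Lc) (X₂ j α μ y ν y') = comp (X₂ j α μ y ν y') (axE (toSite (ctrOff 4 Lc)) Lc))
    (hSrC : ∀ (j : ℕ) (α κ' : Fin 4) (u : Fin 4 → ℤ),
      (JsBal0AtOf (d := 3) hLc.pos (ctrOff_mem_box hLc.pos) cE cVH cΛ W Cw δw hδw hW j).S κ' (bref α κ' u) =
        reflSign α κ' • refK (Φ Lc α)
          ((JsBal0AtOf (d := 3) hLc.pos (ctrOff_mem_box hLc.pos) cE cVH cΛ W Cw δw hδw hW j).S κ' u + conjV (M j) (C j α κ' u)))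
    (hWrC : ∀ (j : ℕ) (α μ : Fin 4) (y : Fin 4 → ℤ) (ν : Fin 4) (y' : Fin 4 → ℤ),
      (JsBal0AtOf (d := 3) hLc.pos (ctrOff_mem_box hLc.pos) cE cVH cΛ W Cw δw hδw hW j).W μ (bref α μ y) ν (bref α ν y') =
        (reflSign α μ * reflSign α ν) • refK (Φ Lc α)
          ((JsBal0AtOf (d := 3) hLc.pos (ctrOff_mem_box hLc.pos) cE cVH cΛ W Cw δw hδw hW j).W μ y ν y' +
            conjW (M j)
              (vertexOfK (coDressKAt (toSite (ctrOff 4 Lc)) Lc (KInvStep (d := 3) Lc j)) Lc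
                (JsBal0AtOf (d := 3) hLc.pos (ctrOff_mem_box hLc.pos) cE cVH cΛ W Cw δw hδw hW j).S μ y)
              (vertexOfK (coDressKAt (toSite (ctrOff 4 Lc)) Lc (KInvStep (d := 3) Lc j)) Lc
                (JsBal0AtOf (d := 3) hLc.pos (ctrOff_mem_box hLc.pos) cE cVH cΛ W Cw δw hδw hW j).S ν y')
              (vertexOfK (coDressKAt (toSite (ctrOff 4 Lc)) Lc (KInvStep (d := 3) Lc j)) Lc (C j α) μ y)
              (vertexOfK (coDressKAt (toSite (ctrOff 4 Lc)) Lc (KInvStep (d := 3) Lc j)) Lc (C j α) ν y') (X₂ j α μ y ν y'))) :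
    ∀ j : ℕ, AxisReflectionCovariant
      (flipK (TbalOf Lc (JsBalAtOf (d := 3) hLc.pos (ctrOff_mem_box hLc.pos) cE cVH cΛ W Cw δw hδw hW) j)) := by
  have hR : ∀ j, RelInv (coDressKAt (toSite (ctrOff 4 Lc)) Lc (KInvStep (d := 3) Lc j)) (M j) (axE (toSite (ctrOff 4 Lc)) Lc) :=
    fun j => ⟨(axE_rules_coDressKAt_KInvStep (ctrOff_mem_box (one_le_of_neZero Lc)) j).1,
      (axE_rules_coDressKAt_KInvStep (ctrOff_mem_box (one_le_of_neZero Lc)) j).2, h3 j, h4 j⟩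
  exact axisReflectionCovariant_flipK_TbalOf_dressCtr_rel hLc
    (JsBal0AtOf (d := 3) hLc.pos (ctrOff_mem_box hLc.pos) cE cVH cΛ W Cw δw hδw hW) M (axE (toSite (ctrOff 4 Lc)) Lc) hM
    (spr_axE _ _) hR (JsBal0AtOf_S_translate hLc.pos (ctrOff_mem_box hLc.pos) cE cVH cΛ W Cw δw hδw hW)
    (JsBal0AtOf_W_translate hLc.pos (ctrOff_mem_box hLc.pos) cE cVH cΛ W Cw δw hδw hW hWt) C Cc δc hC hδc X₂ hX₂ hEC hEX₂ hSrC hWrC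

end

end Summit.QuantumFields.BalabanUV.Beta.SpineRooted
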